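import Summits.KontsevichZagierPeriods.KontsevichZagierPeriods.Theses.TorsionLogs
import Summits.KontsevichZagierPeriods.KontsevichZagierPeriods.Theorems.TorsionLogsNeronTorsionSector
import Literature.NumberTheory.Transcendental.KZKernelConjectureForms

/-!
# Line `NeronTorsionComplexCurve` on crux `TorsionSectorComplete` (stmt-KontsevichZagierPeriods-14212)
# — forward rung G1 (`next-rung`, gen 18) over the PROVED floor `NeronTorsionPrimitiveChain`
#   (seed g1-KontsevichZagierPeriods-17981, `Cruxes.NeronTorsionSector.Translation.stub_assembly`)

RUNG `NeronTorsionComplexCurve := ∀ nonRealCurve : Bool, NeronChordMember nonRealCurve` — the hypothesis of the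
floor that is dropped is THE REAL STRUCTURE OF THE CURVE ITSELF.  Every previous rung on this floor (gens 1–17:
shifted sectors, two-point, duplication/addition/distribution/coset/Jensen, oval, acnodal, height pin, complex POINTS
on a real curve + conjugate fold, argument, depth three, variation/modular arcs, isogeny, genus two) keeps
`g₂ g₃ : ℝ` and a real 2-torsion corner `e₁`; member `true` here has `g₂ g₃ e e' e'' x_P : ℂ` (a torsion point `P`
on an arbitrary complex elliptic curve in Weierstrass form, e.g. a non-real embedding of a curve over a number
field), so neither the floor's translation-invariant real arc `E⁰(ℝ)` (grid cells `x_k = X(kω/n)`, `hper/hsym`) nor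
gen 8's complex-conjugation fold exists.

* member `false` = `Theses.TorsionLogs.NeronTorsionPrimitiveChain` VERBATIM (the floor; F3 witness
  `neronChordMember_false` = `stub_assembly`, `Iff.rfl`).
* member `true`  = `RootChordSector` (typed inline): for the x-CHORD `x(s) = e + s (x_P − e)` from a 2-torsion corner
  `T = (e, 0)` to `P` with a continuous branch `y_c` (`y_c(1) = y_P`, `y_c ≠ 0` on `(0,1]`), the two ROOT CHORDS
  `A : e' → e`, `B : e'' → e` with branches `y_A`, `y_B` (so `ω_A = 2 W_A`, `ω_B = 2 W_B` is a lattice basis up to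
  index, `W_A = ∫₀¹ (e−e') ds / y_A`, and `η(ω_A) = −2 H_A`, `H_A = ∫₀¹ x_A(s)(e−e') ds / y_A`), and the TORSION DATUM
  `2N · W = a'·ω_A + b'·ω_B` (`W = ∫₀¹ (x_P−e) ds/y_c = u_P − u_T`; integers `a' b'`, so `P − T`, hence `P`, is torsion),
  the LENGTH-TWO CHORD INTEGRAL `J = (x_P−e)² ∬_{0<s'<s<1} x(s') ds' ds /(y_c(s') y_c(s))` (inner `η = x dx/y`, outer
  `ω = dx/y`) satisfies the NÉRON–TORSION CHORD IDENTITY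
      `2N² · Re J − Re[(a' W_A + b' W_B)(a' H_A + b' H_B)] = 2N² · (λ̃(P) − λ̃(T)) = 2N² log α_P`,            (♦)
  `λ̃(u) = −log|σ(u)| + ½ Re(u·η(u))` the (Λ-periodic) archimedean Néron function, `λ̃(P) = log|ψ_{n−1}(P)|/(n²−2n)`
  for `n·P = 0`, `λ̃(T) = log|ψ₃(T)|/8` — `α_P` is a real algebraic number when the curve and the points are algebraic
  (seat numerics: 120 random non-real cases, residual ≤ 1.6e−11; the real case `b' = 0` is the floor's
  `I(P) + ρ² ω₁η₁/2 = log α_P`).  The member asserts: every tied integer-cleared element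
  `M[Re J] + k[Re((a'φ_A+b'φ_B) ⊗ (a'χ_A+b'χ_B))] − m[log α]` (`M = −2N²k`, value `0`) lies in `KZ.relations`.

STUBS (registered; `sorry` ONLY here):
* `stub_chordTriangle : ChordTriangle` — the NEW MOVE, torsion-free and curve-agnostic: for a solid triangle
  `x₀x₁x₂ ⊂ ℂ` on which a continuous branch `Y` of `√f` exists and vanishes at most at the vertex `x₀`,
  `[Re J(x₀→x₂)] − [Re J(x₀→x₁)] − [Re J(x₁→x₂)] − [Re(H(x₀→x₁) ⊗ W(x₁→x₂))] ∈ KZ.relations` (Cauchy for the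
  holomorphic forms `ω, η` + Chen's concatenation formula, realised as ONE rule-3 Stokes move on the 3-dimensional
  prism `{s' < s} × [0,1]_t` of the straight-line homotopy, whose primitives are the algebraic densities themselves,
  the face `t`-terms vanishing because `η ∧ ω = 0` on a curve).  The floor's closed support `TriangleConcatenation`
  (stmt-13809) is its degenerate COLLINEAR REAL case (rule 1 only).
* `stub_orbitChain : OrbitChain := ChordTriangle → RootChordPrimitiveChain` — the floor's translation chain
  transplanted from the real arc to the CHORD POLYGON through the orbit `T + k(P−T)`, `k = 0…2N`: translate the chord
  by `P − T` (rule 2; cocycle `τ*η = η + dG`, `G` algebraic by the addition formula for `ζ`), straighten each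
  translated arc onto the next chord (stub 1), evaluate the closed polygon of class `a'ω_A + b'ω_B` against the root
  loops (stub 1 again + shuffle: `Re ∮_γ[η|ω] = −½ Re(Ω η(Ω))`, "Legendre for torsion polygons", replacing the
  floor's `hper/hsym`), unfold `d log|g|² ` of the norm certificate `g` (divisor supported on the orbit) into a log
  carrier, eliminate the integers.  HARDEST stub (L–XL).
* `stub_chordSectorComplete : ChordSectorComplete` — the declared RESIDUAL: completeness relative to
  `relations ⊔ closure (T ∪ T^{chord})`; WEAKER than the crux as typed (`chordSectorComplete_of_torsionSectorComplete`).

COMPOSITION (kernel-checked, no `sorry` outside the stubs): `rootChordPrimitiveChain_of`, `chordSector_of_chain`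
(bookkeeping: soundness of the calculus for values + the landed interval-log calculus), `neronTorsionComplexCurve_of`
(THE RUNG from stubs 1–2 and the floor), `closure_chordTied_le_relations`, `TorsionSectorComplete_of` (the crux BY
NAME from the three stubs).  F4 on-path: `neronTorsionComplexCurve_of_kontsevichZagierPeriods : S → rung` (sorry-free,
also in `Lines/NeronTorsionComplexCurve_onpath.lean`); F3: `neronChordMember_false` (also
`Lines/NeronTorsionComplexCurve_special.lean`).
[cite: KontsevichZagier2001, §1.2 Conjecture 1] [cite: Lang1983, Ch. 13 Thm 1.1] [cite: Silverman1994, VI.1–VI.4]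
-/

noncomputable section

open Set MeasureTheory Filter Topology
open Literature.NumberTheory.Transcendental Literature.ModelTheory.ExponentialFields
open Summit.KontsevichZagierPeriods.KontsevichZagierPeriods.Theses.TorsionLogs (NeronTorsionPrimitiveChain TorsionSectorComplete)
open Summit.KontsevichZagierPeriods.HyperbolicBloch.OffTetraSectorKernel (interval_log_relation_mem_relations)
open Summit.KontsevichZagierPeriods.KontsevichZagierPeriods.Cruxes.NeronTorsionSector.Translation (logRep_value
  isAlgebraic_of_logRep stub_assembly)

-- `Summit.KontsevichZagierPeriods.KontsevichZagierPeriods.…` is the tree's mandated layout (single-conjunct summit).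
set_option linter.dupNamespace false

namespace Summit.KontsevichZagierPeriods.KontsevichZagierPeriods.Cruxes.TorsionSectorComplete.NeronTorsionComplexCurve

/-! ### The rung: a Bool-indexed family of tied Néron–torsion sectors -/

/-- The two members.  `false` ↦ the floor `NeronTorsionPrimitiveChain` VERBATIM (real curve, real torsion point on
the identity component, primitive chain `q²[I(P)] + p²[η₁ω₁/2] − c[log B]`).  `true` ↦ `RootChordSector`: an
ARBITRARY COMPLEX curve `y² = f(x) = 4x³ − g₂x − g₃ = 4(x−e)(x−e')(x−e'')`, a point `P = (x_P, y_c(1))` joined to the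
2-torsion corner `T = (e,0)` by the x-chord `x(s) = e + s(x_P − e)` with continuous branch `y_c`, the root chords
`A : e' → e`, `B : e'' → e` with branches `y_A, y_B`, the torsion datum `2N·W = a'ω_A + b'ω_B` (`ω_A = 2W_A`,
`ω_B = 2W_B`), and a tied integer-cleared element `M[Re J] + k[Re((a'φ_A+b'φ_B)⊗(a'χ_A+b'χ_B))] − m[1<t<α, 1/t]`
(`M = −2N²k`) of value `0`, claimed to lie in `KZ.relations` (identity (♦) of the module docstring).
[cite: KontsevichZagier2001, §1.2] [cite: Lang1983, Ch. 13 Thm 1.1] -/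
def NeronChordMember : Bool → Prop
  | false => ∀ (g₂ g₃ e₁ xP yP : ℝ) (N a p q : ℕ) (f : ℝ → ℝ), (∀ x, f x = 4 * x ^ 3 - g₂ * x - g₃) → g₂ ^ 3 - 27 * g₃ ^ 2 ≠ 0 → f e₁ = 0 → 0 < e₁ → (∀ x, e₁ < x → 0 < f x) → e₁ < xP → yP ^ 2 = f xP → 3 ≤ N → 0 < a → 2 * a < N → (∀ hns : (⟨0, 0, 0, -g₂ / 4, -g₃ / 4⟩ : WeierstrassCurve ℝ).toAffine.Nonsingular xP (yP / 2), addOrderOf (WeierstrassCurve.Affine.Point.some xP (yP / 2) hns) = N) → (N : ℝ) * (∫ x in Set.Ioi xP, (Real.sqrt (f x))⁻¹) = a * (2 * ∫ x in Set.Ioi e₁, (Real.sqrt (f x))⁻¹) → Nat.Coprime p q → (q : ℤ) * ((N : ℤ) - 2 * (a : ℤ)) = (p : ℤ) * (2 * (N : ℤ)) → ∀ (rI rP : Literature.NumberTheory.Transcendental.KZ.IntegralRep 2), rI.domain = {z | e₁ < z 1 ∧ z 1 < z 0 ∧ z 0 < xP} → Set.EqOn rI.integrand (fun z => z 1 / (Real.sqrt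 (f (z 1)) * Real.sqrt (f (z 0)))) rI.domain → rP.domain = {z | e₁ < z 0 ∧ e₁ < z 1} → Set.EqOn rP.integrand (fun z => (Real.sqrt (f (z 0)))⁻¹ * ((g₂ * z 1 + 2 * g₃) / (2 * (z 1) ^ 2 * Real.sqrt (f (z 1))))) rP.domain → ∃ (c : ℤ) (B : ℝ) (rB : Literature.NumberTheory.Transcendental.KZ.IntegralRep 1), 1 < B ∧ IsAlgebraic ℚ B ∧ rB.domain = {t | 1 < t 0 ∧ t 0 < B} ∧ Set.EqOn rB.integrand (fun t => (t 0)⁻¹) rB.domain ∧ ((q : ℤ) ^ 2) • Literature.NumberTheory.Transcendental.KZ.of rI + ((p : ℤ) ^ 2) • Literature.NumberTheory.Transcendental.KZ.of rP - c • Literature.NumberTheory.Transcendental.KZ.of rB ∈ Literature.NumberTheory.Transcendental.KZ.relations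
  | true => ∀ (g₂ g₃ e e' e'' xP yP : ℂ) (yc yA yB : ℝ → ℂ) (α : ℝ) (N : ℕ) (a' b' M k m : ℤ) (f : ℂ → ℂ), (∀ x, f x = 4 * x ^ 3 - g₂ * x - g₃) → f e = 0 → f e' = 0 → f e'' = 0 → e ≠ e' → e ≠ e'' → e' ≠ e'' → ContinuousOn yc (Set.Icc 0 1) → yc 1 = yP → (∀ s ∈ Set.Icc (0 : ℝ) 1, yc s ^ 2 = f (e + (s : ℂ) * (xP - e))) → (∀ s ∈ Set.Ioc (0 : ℝ) 1, yc s ≠ 0) → ContinuousOn yA (Set.Icc 0 1) → (∀ s ∈ Set.Icc (0 : ℝ) 1, yA s ^ 2 = f (e' + (s : ℂ) * (e - e'))) → (∀ s ∈ Set.Ioo (0 : ℝ) 1, yA s ≠ 0) → ContinuousOn yB (Set.Icc 0 1) → (∀ s ∈ Set.Icc (0 : ℝ) 1, yB s ^ 2 = f (e'' + (s : ℂ) * (e - e''))) → (∀ s ∈ Set.Ioo (0 : ℝ) 1, yB s ≠ 0) → 0 < N → (2 * (N : ℂ)) * (∫ s in Set.Ioo (0 : ℝ) 1, (xP - e) /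 yc s) = (a' : ℂ) * (2 * ∫ s in Set.Ioo (0 : ℝ) 1, (e - e') / yA s) + (b' : ℂ) * (2 * ∫ s in Set.Ioo (0 : ℝ) 1, (e - e'') / yB s) → M = -2 * (N : ℤ) ^ 2 * k → 1 < α → ∀ (rJ rC : Literature.NumberTheory.Transcendental.KZ.IntegralRep 2) (rL : Literature.NumberTheory.Transcendental.KZ.IntegralRep 1), rJ.domain = {z | 0 < z 1 ∧ z 1 < z 0 ∧ z 0 < 1} → Set.EqOn rJ.integrand (fun z => ((xP - e) ^ 2 * (e + ((z 1 : ℝ) : ℂ) * (xP - e)) / (yc (z 1) * yc (z 0))).re) rJ.domain → rC.domain = {z | 0 < z 0 ∧ z 0 < 1 ∧ 0 < z 1 ∧ z 1 < 1} → Set.EqOn rC.integrand (fun z => (((a' : ℂ) * ((e - e') / yA (z 0)) + (b' : ℂ) * ((e - e'') / yB (z 0))) * ((a' : ℂ) * ((e' + ((z 1 : ℝ) : ℂ) * (e - e')) * (e - e') / yA (z 1)) + (b' : ℂ) * ((e'' + ((z 1 : ℝ) : ℂ) * (e - e'')) * (e - e'') / yB (z 1)))).re) rC.domain → rL.domain =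 {t | 1 < t 0 ∧ t 0 < α} → Set.EqOn rL.integrand (fun t => (t 0)⁻¹) rL.domain → (M : ℝ) * rJ.value + k * rC.value = m * rL.value → M • Literature.NumberTheory.Transcendental.KZ.of rJ + k • Literature.NumberTheory.Transcendental.KZ.of rC - m • Literature.NumberTheory.Transcendental.KZ.of rL ∈ Literature.NumberTheory.Transcendental.KZ.relations

/-- **THE RUNG.** Both members: the floor (real curve) and the root-chord sector (arbitrary complex curve). -/
def NeronTorsionComplexCurve : Prop := ∀ nonRealCurve : Bool, NeronChordMember nonRealCurve

/-- The PRIMITIVE CHORD CHAIN (what stubs 1–2 produce; the `∃`-form of member `true` at the primitive vector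
`(2N², −1)`): a log carrier `[1<t<B, 1/t]`, `B > 1` real algebraic, and `c ∈ ℤ` with
`2N²[Re J] − [Re((a'φ_A+b'φ_B)⊗(a'χ_A+b'χ_B))] − c[log B] ∈ KZ.relations`. [cite: KontsevichZagier2001, §1.2] -/
def RootChordPrimitiveChain : Prop := ∀ (g₂ g₃ e e' e'' xP yP : ℂ) (yc yA yB : ℝ → ℂ) (N : ℕ) (a' b' : ℤ) (f : ℂ → ℂ), (∀ x, f x = 4 * x ^ 3 - g₂ * x - g₃) → f e = 0 → f e' = 0 → f e'' = 0 → e ≠ e' → e ≠ e'' → e' ≠ e'' → ContinuousOn yc (Set.Icc 0 1) → yc 1 = yP → (∀ s ∈ Set.Icc (0 : ℝ) 1, yc s ^ 2 = f (e + (s : ℂ) * (xP - e))) → (∀ s ∈ Set.Ioc (0 : ℝ) 1, yc s ≠ 0) → ContinuousOn yA (Set.Icc 0 1) → (∀ s ∈ Set.Icc (0 : ℝ) 1, yA s ^ 2 = f (e' + (s : ℂ) * (e - e'))) → (∀ s ∈ Set.Ioo (0 : ℝ) 1, yA s ≠ 0) → ContinuousOn yB (Set.Icc 0 1) → (∀ s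 ∈ Set.Icc (0 : ℝ) 1, yB s ^ 2 = f (e'' + (s : ℂ) * (e - e''))) → (∀ s ∈ Set.Ioo (0 : ℝ) 1, yB s ≠ 0) → 0 < N → (2 * (N : ℂ)) * (∫ s in Set.Ioo (0 : ℝ) 1, (xP - e) / yc s) = (a' : ℂ) * (2 * ∫ s in Set.Ioo (0 : ℝ) 1, (e - e') / yA s) + (b' : ℂ) * (2 * ∫ s in Set.Ioo (0 : ℝ) 1, (e - e'') / yB s) → ∀ (rJ rC : Literature.NumberTheory.Transcendental.KZ.IntegralRep 2), rJ.domain = {z | 0 < z 1 ∧ z 1 < z 0 ∧ z 0 < 1} → Set.EqOn rJ.integrand (fun z => ((xP - e) ^ 2 * (e + ((z 1 : ℝ) : ℂ) * (xP - e)) / (yc (z 1) * yc (z 0))).re) rJ.domain → rC.domain = {z | 0 < z 0 ∧ z 0 < 1 ∧ 0 < z 1 ∧ z 1 < 1} → Set.EqOn rC.integrand (fun z => (((a' : ℂ) * ((e - e') / yA (z 0)) + (b' : ℂ) * ((e - e'') / yB (z 0))) * ((a' : ℂ) * ((e' + ((z 1 : ℝ) : ℂ) * (e - e')) * (e - e')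 / yA (z 1)) + (b' : ℂ) * ((e'' + ((z 1 : ℝ) : ℂ) * (e - e'')) * (e - e'') / yB (z 1)))).re) rC.domain → ∃ (c : ℤ) (B : ℝ) (rB : Literature.NumberTheory.Transcendental.KZ.IntegralRep 1), 1 < B ∧ IsAlgebraic ℚ B ∧ rB.domain = {t | 1 < t 0 ∧ t 0 < B} ∧ Set.EqOn rB.integrand (fun t => (t 0)⁻¹) rB.domain ∧ (2 * (N : ℤ) ^ 2) • Literature.NumberTheory.Transcendental.KZ.of rJ - Literature.NumberTheory.Transcendental.KZ.of rC - c • Literature.NumberTheory.Transcendental.KZ.of rB ∈ Literature.NumberTheory.Transcendental.KZ.relations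

/-! ### Stub statements -/

/-- **Stub 1 — the chord-triangle move (Cauchy–Chen).**  For a solid triangle `x₀x₁x₂ ⊂ ℂ` carrying a continuous
branch `Y` of `√f` that vanishes at most at the vertex `x₀`, the length-two chord integrals
`J(a→b) = (b−a)² ∬_{0<s'<s<1} x_{ab}(s') ds' ds / (Y(x_{ab}(s')) Y(x_{ab}(s)))` (`x_{ab}(s) = a + s(b−a)`; inner
`η = x dx/Y`, outer `ω = dx/Y`) and the 1-chord integrals `H(a→b) = ∫ x_{ab}(b−a)ds/Y`, `W(a→b) = ∫ (b−a)ds/Y` satisfy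
`[Re J(x₀→x₂)] − [Re J(x₀→x₁)] − [Re J(x₁→x₂)] − [Re(H(x₀→x₁) ⊗ W(x₁→x₂))] ∈ KZ.relations` (as values: homotopy
invariance of Chen's iterated integral of the closed holomorphic forms `η, ω` with `η ∧ ω = 0`, plus the
concatenation formula; as MOVES: one rule-3 Stokes step on the prism of the straight-line homotopy with the algebraic
densities as primitives, rule 1 for the pointwise identity `χ̃φ − χφ̃ = 0`).  Torsion-free, new on this summit's
tree (its collinear real shadow is the closed support `TriangleConcatenation`). [cite: KontsevichZagier2001, §1.2] -/
def ChordTriangle : Prop := ∀ (g₂ g₃ x₀ x₁ x₂ : ℂ) (Y f : ℂ → ℂ), (∀ x, f x = 4 * x ^ 3 - g₂ * x - g₃) → ContinuousOn Y (convexHull ℝ ({x₀, x₁, x₂} : Set ℂ)) → (∀ z ∈ convexHull ℝ ({x₀, x₁, x₂} : Set ℂ), Y z ^ 2 = f z) → (∀ z ∈ convexHull ℝ ({x₀, x₁, x₂} : Set ℂ), z ≠ x₀ → Y z ≠ 0) → ∀ (rJ₀₂ rJ₀₁ rJ₁₂ rHW : Literature.NumberTheory.Transcendental.KZ.IntegralRep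 2), rJ₀₂.domain = {z | 0 < z 1 ∧ z 1 < z 0 ∧ z 0 < 1} → Set.EqOn rJ₀₂.integrand (fun z => ((x₂ - x₀) ^ 2 * (x₀ + ((z 1 : ℝ) : ℂ) * (x₂ - x₀)) / (Y (x₀ + ((z 1 : ℝ) : ℂ) * (x₂ - x₀)) * Y (x₀ + ((z 0 : ℝ) : ℂ) * (x₂ - x₀)))).re) rJ₀₂.domain → rJ₀₁.domain = {z | 0 < z 1 ∧ z 1 < z 0 ∧ z 0 < 1} → Set.EqOn rJ₀₁.integrand (fun z => ((x₁ - x₀) ^ 2 * (x₀ + ((z 1 : ℝ) : ℂ) * (x₁ - x₀)) / (Y (x₀ + ((z 1 : ℝ) : ℂ) * (x₁ - x₀)) * Y (x₀ + ((z 0 : ℝ) : ℂ) * (x₁ - x₀)))).re) rJ₀₁.domain → rJ₁₂.domain = {z | 0 < z 1 ∧ z 1 < z 0 ∧ z 0 < 1} → Set.EqOn rJ₁₂.integrand (fun z => ((x₂ - x₁) ^ 2 * (x₁ + ((z 1 : ℝ) : ℂ) * (x₂ - x₁)) / (Y (x₁ + ((z 1 : ℝ) : ℂ) * (x₂ - x₁))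 * Y (x₁ + ((z 0 : ℝ) : ℂ) * (x₂ - x₁)))).re) rJ₁₂.domain → rHW.domain = {z | 0 < z 0 ∧ z 0 < 1 ∧ 0 < z 1 ∧ z 1 < 1} → Set.EqOn rHW.integrand (fun z => (((x₀ + ((z 0 : ℝ) : ℂ) * (x₁ - x₀)) * (x₁ - x₀) / Y (x₀ + ((z 0 : ℝ) : ℂ) * (x₁ - x₀))) * ((x₂ - x₁) / Y (x₁ + ((z 1 : ℝ) : ℂ) * (x₂ - x₁)))).re) rHW.domain → Literature.NumberTheory.Transcendental.KZ.of rJ₀₂ - Literature.NumberTheory.Transcendental.KZ.of rJ₀₁ - Literature.NumberTheory.Transcendental.KZ.of rJ₁₂ - Literature.NumberTheory.Transcendental.KZ.of rHW ∈ Literature.NumberTheory.Transcendental.KZ.relations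

/-- **Stub 2 — the orbit-polygon chain (HARDEST).**  Given the chord-triangle move, the primitive chord chain:
translate the chord `T → P` by `P − T` around the orbit `T_k = T + k(P − T)` (`k = 0,…,2N`, `T_{2N} = T`; rule 2,
the algebraic translation `τ_{P−T}`, cocycle `τ*η = η + dG` with `G` rational by the addition formula for `ζ`),
straighten every translated arc onto the chord `T_k → T_{k+1}` (stub 1), evaluate the closed chord polygon of class
`Ω = a'ω_A + b'ω_B` against the root loops `A`, `B` (stub 1 + shuffle; `Re ∮_γ[η|ω] = −½ Re(Ω·η(Ω))`, the real part
killing every `2πi` from the pole of `η` and from commutators — Legendre's relation for torsion polygons, replacing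
the floor's `hper/hsym`), unfold `d log|g|²` of the norm certificate `g` (divisor on the orbit) into a log carrier
(the floor's `CertificateDlogUnfolds`, applied to the positive real algebraic function `|g(x(s), y_c(s))|²`), and
eliminate the integers `a', b', N`.  Why it might fail: only by size — every ingredient is algebraic and the value
identity (♦) is checked numerically; the risk is the 3-dimensional Stokes bookkeeping on non-product domains.
[cite: KontsevichZagier2001, §1.2] [cite: Lang1983, Ch. 13] [cite: Silverman1994, VI.3–VI.4] -/
def OrbitChain : Prop := ChordTriangle → RootChordPrimitiveChain

/-- The torsion tied set `T` of the route's crux — VERBATIM the set inside `Theses.TorsionLogs.TorsionSectorComplete`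
(so that `torsionSectorComplete_iff` is `Iff.rfl`). -/
def TorsionTied : Set Literature.NumberTheory.Transcendental.KZ.FormalRep := {d : Literature.NumberTheory.Transcendental.KZ.FormalRep | ∃ (g₂ g₃ e₁ xP yP α : ℝ) (N a : ℕ) (M k m : ℤ) (f : ℝ → ℝ) (rI rP : Literature.NumberTheory.Transcendental.KZ.IntegralRep 2) (rL : Literature.NumberTheory.Transcendental.KZ.IntegralRep 1), (∀ x, f x = 4 * x ^ 3 - g₂ * x - g₃) ∧ g₂ ^ 3 - 27 * g₃ ^ 2 ≠ 0 ∧ f e₁ = 0 ∧ 0 < e₁ ∧ (∀ x, e₁ < x → 0 < f x) ∧ e₁ < xP ∧ yP ^ 2 = f xP ∧ 3 ≤ N ∧ 0 < a ∧ 2 * a < N ∧ 4 * (N : ℤ) ^ 2 * k = M * ((N : ℤ) - 2 * (a : ℤ)) ^ 2 ∧ (∀ hns : (⟨0, 0, 0, -g₂ / 4, -g₃ / 4⟩ : WeierstrassCurve ℝ).toAffine.Nonsingular xP (yP / 2), addOrderOf (WeierstrassCurve.Affine.Point.some xP (yP / 2) hns) = N) ∧ (N : ℝ) * (∫ x in Set.Ioi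 xP, (Real.sqrt (f x))⁻¹) = a * (2 * ∫ x in Set.Ioi e₁, (Real.sqrt (f x))⁻¹) ∧ 1 < α ∧ rI.domain = {z | e₁ < z 1 ∧ z 1 < z 0 ∧ z 0 < xP} ∧ Set.EqOn rI.integrand (fun z => z 1 / (Real.sqrt (f (z 1)) * Real.sqrt (f (z 0)))) rI.domain ∧ rP.domain = {z | e₁ < z 0 ∧ e₁ < z 1} ∧ Set.EqOn rP.integrand (fun z => (Real.sqrt (f (z 0)))⁻¹ * ((g₂ * z 1 + 2 * g₃) / (2 * (z 1) ^ 2 * Real.sqrt (f (z 1))))) rP.domain ∧ rL.domain = {t | 1 < t 0 ∧ t 0 < α} ∧ Set.EqOn rL.integrand (fun t => (t 0)⁻¹) rL.domain ∧ (M : ℝ) * rI.value + k * rP.value = m * rL.value ∧ d = M • Literature.NumberTheory.Transcendental.KZ.of rI + k • Literature.NumberTheory.Transcendental.KZ.of rP - m • Literature.NumberTheory.Transcendental.KZ.of rL}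

/-- The chord tied set `T^{chord}` (the elements of member `true`). -/
def ChordTied : Set Literature.NumberTheory.Transcendental.KZ.FormalRep := {d : Literature.NumberTheory.Transcendental.KZ.FormalRep | ∃ (g₂ g₃ e e' e'' xP yP : ℂ) (yc yA yB : ℝ → ℂ) (α : ℝ) (N : ℕ) (a' b' M k m : ℤ) (f : ℂ → ℂ) (rJ rC : Literature.NumberTheory.Transcendental.KZ.IntegralRep 2) (rL : Literature.NumberTheory.Transcendental.KZ.IntegralRep 1), (∀ x, f x = 4 * x ^ 3 - g₂ * x - g₃) ∧ f e = 0 ∧ f e' = 0 ∧ f e'' = 0 ∧ e ≠ e' ∧ e ≠ e'' ∧ e' ≠ e'' ∧ ContinuousOn yc (Set.Icc 0 1) ∧ yc 1 = yP ∧ (∀ s ∈ Set.Icc (0 : ℝ) 1, yc s ^ 2 = f (e + (s : ℂ) * (xP - e))) ∧ (∀ s ∈ Set.Ioc (0 : ℝ) 1, yc s ≠ 0) ∧ ContinuousOn yA (Set.Icc 0 1) ∧ (∀ s ∈ Set.Icc (0 : ℝ) 1, yA s ^ 2 = f (e' + (s : ℂ) * (e - e'))) ∧ (∀ s ∈ Set.Ioo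 (0 : ℝ) 1, yA s ≠ 0) ∧ ContinuousOn yB (Set.Icc 0 1) ∧ (∀ s ∈ Set.Icc (0 : ℝ) 1, yB s ^ 2 = f (e'' + (s : ℂ) * (e - e''))) ∧ (∀ s ∈ Set.Ioo (0 : ℝ) 1, yB s ≠ 0) ∧ 0 < N ∧ (2 * (N : ℂ)) * (∫ s in Set.Ioo (0 : ℝ) 1, (xP - e) / yc s) = (a' : ℂ) * (2 * ∫ s in Set.Ioo (0 : ℝ) 1, (e - e') / yA s) + (b' : ℂ) * (2 * ∫ s in Set.Ioo (0 : ℝ) 1, (e - e'') / yB s) ∧ M = -2 * (N : ℤ) ^ 2 * k ∧ 1 < α ∧ rJ.domain = {z | 0 < z 1 ∧ z 1 < z 0 ∧ z 0 < 1} ∧ Set.EqOn rJ.integrand (fun z => ((xP - e) ^ 2 * (e + ((z 1 : ℝ) : ℂ) * (xP - e)) / (yc (z 1) * yc (z 0))).re) rJ.domain ∧ rC.domain = {z | 0 < z 0 ∧ z 0 < 1 ∧ 0 < z 1 ∧ z 1 < 1} ∧ Set.EqOn rC.integrand (fun z => (((a' : ℂ) * ((e - e') / yA (z 0)) + (b'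 : ℂ) * ((e - e'') / yB (z 0))) * ((a' : ℂ) * ((e' + ((z 1 : ℝ) : ℂ) * (e - e')) * (e - e') / yA (z 1)) + (b' : ℂ) * ((e'' + ((z 1 : ℝ) : ℂ) * (e - e'')) * (e - e'') / yB (z 1)))).re) rC.domain ∧ rL.domain = {t | 1 < t 0 ∧ t 0 < α} ∧ Set.EqOn rL.integrand (fun t => (t 0)⁻¹) rL.domain ∧ (M : ℝ) * rJ.value + k * rC.value = m * rL.value ∧ d = M • Literature.NumberTheory.Transcendental.KZ.of rJ + k • Literature.NumberTheory.Transcendental.KZ.of rC - m • Literature.NumberTheory.Transcendental.KZ.of rL}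

/-- **Stub 3 — the declared RESIDUAL `ChordSectorComplete`:** completeness of the calculus relative to
`relations ⊔ closure (T ∪ T^{chord})`.  WEAKER than the crux as typed (`chordSectorComplete_of_torsionSectorComplete`);
conjecture-grade (the Grothendieck-strength kernel statement off the enlarged sector); expected stamp open-problem.
[cite: KontsevichZagier2001, §1.2] [cite: HuberMullerStachPeriods2017, §13.2] -/
def ChordSectorComplete : Prop := ∀ ⦃n m : ℕ⦄ (r : Literature.NumberTheory.Transcendental.KZ.IntegralRep n) (r' : Literature.NumberTheory.Transcendental.KZ.IntegralRep m), r.IsRational → r'.IsRational → r.value = r'.value → Literature.NumberTheory.Transcendental.KZ.of r - Literature.NumberTheory.Transcendental.KZ.of r' ∈ Literature.NumberTheory.Transcendental.KZ.relations ⊔ AddSubgroup.closure (TorsionTied ∪ ChordTied)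

/-! ### Registered stubs (`sorry` ONLY here) -/

/-- stub 1 · the chord-triangle move (Cauchy–Chen as one rule-3 move with algebraic primitives) · size M–L. -/
theorem stub_chordTriangle : ChordTriangle := by
  sorry

/-- stub 2 · the orbit-polygon chain (translation cocycle on chords + polygon period + dlog unfolding) · size L–XL ·
HARDEST. -/
theorem stub_orbitChain : OrbitChain := by
  sorry

/-- stub 3 · the residual relative completeness · conjecture-grade. -/
theorem stub_chordSectorComplete : ChordSectorComplete := by
  sorry

/-! ### Kernel-checked infrastructure (no `sorry` below this line) -/

/-- The crux unfolds to completeness relative to `relations ⊔ closure T`. -/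
theorem torsionSectorComplete_iff :
    Summit.KontsevichZagierPeriods.KontsevichZagierPeriods.Theses.TorsionLogs.TorsionSectorComplete ↔
      ∀ ⦃n m : ℕ⦄ (r : Literature.NumberTheory.Transcendental.KZ.IntegralRep n)
        (r' : Literature.NumberTheory.Transcendental.KZ.IntegralRep m), r.IsRational → r'.IsRational →
        r.value = r'.value → Literature.NumberTheory.Transcendental.KZ.of r - Literature.NumberTheory.Transcendental.KZ.of r' ∈
          Literature.NumberTheory.Transcendental.KZ.relations ⊔ AddSubgroup.closure TorsionTied :=
  Iff.rfl

/-- Member `false` of the family is the floor `NeronTorsionPrimitiveChain` on the nose. -/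
theorem neronChordMember_false_iff :
    NeronChordMember false ↔
      Summit.KontsevichZagierPeriods.KontsevichZagierPeriods.Theses.TorsionLogs.NeronTorsionPrimitiveChain :=
  Iff.rfl

/-- The primitive chord chain follows from the two content stubs. -/
theorem rootChordPrimitiveChain_of (h₁ : ChordTriangle) (h₂ : OrbitChain) : RootChordPrimitiveChain := h₂ h₁

/-- **Bookkeeping: the primitive chord chain gives the tied chord sector** — the chain at the vector `(M, k)` on the
tie line `M = −2N²k`, soundness of the calculus for the value, algebraicity of the end point of a log carrier, and
the landed interval-log calculus for `(kc)•[rB] + m•[rL]`. [cite: KontsevichZagier2001, §1.2] -/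
theorem chordSector_of_chain (hPC : RootChordPrimitiveChain) : NeronChordMember true := by
  intro g₂ g₃ e e' e'' xP yP yc yA yB α N a' b' M k m f hf he he' he'' hd₁ hd₂ hd₃ hyc hyc1 hycsq hyc0 hyA hyAsq
    hyA0 hyB hyBsq hyB0 hN htor htie hα rJ rC rL hdJ hiJ hdC hiC hdL hiL hval
  obtain ⟨c, B, rB, hB, hBalg, hdB, hiB, hprim⟩ :=
    hPC g₂ g₃ e e' e'' xP yP yc yA yB N a' b' f hf he he' he'' hd₁ hd₂ hd₃ hyc hyc1 hycsq hyc0 hyA hyAsq hyA0 hyB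
      hyBsq hyB0 hN htor rJ rC hdJ hiJ hdC hiC
  have hvB : rB.value = Real.log B := logRep_value hB.le rB hdB hiB
  have hvL : rL.value = Real.log α := logRep_value hα.le rL hdL hiL
  have hαalg : IsAlgebraic ℚ α := isAlgebraic_of_logRep hα rL hdL
  have h0 : (2 * (N : ℝ) ^ 2) * rJ.value - rC.value - c * Real.log B = 0 := by
    have h := KZ.relations_le_ker_eval_holds hprim
    rw [AddMonoidHom.mem_ker] at h
    simpa only [map_add, map_sub, map_zsmul, KZ.eval_of, zsmul_eq_mul, hvB, Int.cast_mul, Int.cast_pow,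
      Int.cast_ofNat, Int.cast_natCast] using h
  have htie' : (M : ℝ) = -2 * (N : ℝ) ^ 2 * k := by exact_mod_cast htie
  have hlog : ((k * c : ℤ) : ℝ) * Real.log B + m * Real.log α = 0 := by
    rw [hvL] at hval
    push_cast
    linear_combination (-(k : ℝ)) * h0 - hval + rJ.value * htie'
  have hiB1 : Set.EqOn rB.integrand (fun t : Fin 1 → ℝ => 1 / t 0) rB.domain := fun t ht => by
    simp only [hiB ht, one_div]
  have hiL1 : Set.EqOn rL.integrand (fun t : Fin 1 → ℝ => 1 / t 0) rL.domain := fun t ht => by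
    simp only [hiL ht, one_div]
  have hL : (k * c) • KZ.of rB + m • KZ.of rL ∈ KZ.relations := by
    have h := interval_log_relation_mem_relations 2 ![1, 1] ![B, α] ![k * c, m] ![rB, rL]
      (fun i => by fin_cases i <;> simp)
      (fun i => by fin_cases i <;> simp [hB.le, hα.le])
      (fun i => by fin_cases i <;> exact isAlgebraic_one)
      (fun i => by fin_cases i <;> simp [hBalg, hαalg])
      (fun i => by
        fin_cases i
        · exact ⟨hdB, hiB1⟩
        · exact ⟨hdL, hiL1⟩)
      (by
        simp only [Fin.sum_univ_two, Matrix.cons_val_zero, Matrix.cons_val_one, div_one]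
        linear_combination hlog)
    have e : ∑ i : Fin 2, (![k * c, m] i : ℤ) • KZ.of (![rB, rL] i) = (k * c) • KZ.of rB + m • KZ.of rL := by
      simp only [Fin.sum_univ_two, Matrix.cons_val_zero, Matrix.cons_val_one]
    rw [e] at h
    exact h
  have e : M • KZ.of rJ + k • KZ.of rC - m • KZ.of rL =
      (-k) • ((2 * (N : ℤ) ^ 2) • KZ.of rJ - KZ.of rC - c • KZ.of rB) - ((k * c) • KZ.of rB + m • KZ.of rL) := by
    subst htie
    module
  rw [e]
  exact KZ.relations.sub_mem (KZ.relations.zsmul_mem hprim _) hL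

/-- **F3 WITNESS — the floor is member `false` of the family** (names the seed `stub_assembly`). -/
theorem neronChordMember_false : NeronChordMember false :=
  neronChordMember_false_iff.mpr stub_assembly

/-- F3 in the brief's literal shape `example : Rung <floor index> := by simpa [Rung] using <seed>`. -/
example : NeronChordMember false :=
  (stub_assembly : Summit.KontsevichZagierPeriods.KontsevichZagierPeriods.Theses.TorsionLogs.NeronTorsionPrimitiveChain)

/-- **THE RUNG from the two content stubs** (member `false` is the proved floor). -/
theorem neronTorsionComplexCurve_of (h₁ : ChordTriangle) (h₂ : OrbitChain) : NeronTorsionComplexCurve := by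
  intro b
  cases b
  · exact neronChordMember_false
  · exact chordSector_of_chain (rootChordPrimitiveChain_of h₁ h₂)

/-- The rung holds (through the registered stubs 1–2 only). -/
theorem neronTorsionComplexCurve_holds : NeronTorsionComplexCurve :=
  neronTorsionComplexCurve_of stub_chordTriangle stub_orbitChain

/-- The rung restricted to the floor's index is exactly what the floor proves. -/
theorem neronTorsionComplexCurve_iff_true : NeronTorsionComplexCurve ↔ NeronChordMember true :=
  ⟨fun h => h true, fun h b => by cases b <;> [exact neronChordMember_false; exact h]⟩

/-- The chord member says exactly `closure T^{chord} ≤ KZ.relations`. [cite: KontsevichZagier2001, §1.2] -/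
theorem closure_chordTied_le_relations (h : NeronChordMember true) :
    AddSubgroup.closure ChordTied ≤ Literature.NumberTheory.Transcendental.KZ.relations := by
  refine (AddSubgroup.closure_le _).mpr ?_
  rintro d ⟨g₂, g₃, e, e', e'', xP, yP, yc, yA, yB, α, N, a', b', M, k, m', f, rJ, rC, rL, hf, he, he', he'', hd₁,
    hd₂, hd₃, hyc, hyc1, hycsq, hyc0, hyA, hyAsq, hyA0, hyB, hyBsq, hyB0, hN, htor, htie, hα, hdJ, hiJ, hdC, hiC,
    hdL, hiL, hval, rfl⟩
  exact h g₂ g₃ e e' e'' xP yP yc yA yB α N a' b' M k m' f hf he he' he'' hd₁ hd₂ hd₃ hyc hyc1 hycsq hyc0 hyA hyAsq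
    hyA0 hyB hyBsq hyB0 hN htor htie hα rJ rC rL hdJ hiJ hdC hiC hdL hiL hval

/-- **F4 ON-PATH LEMMA — the summit implies the rung** (member `false` is a theorem outright; member `true` by
Conjecture 1 in kernel form, `kzKernelConjecture_iff_isRational`: a tied element evaluates to `0` by its value
hypothesis).  Tagged `@[simp]` for the tribunal's forward probe. [cite: KontsevichZagier2001, §1.2] -/
@[simp] theorem neronTorsionComplexCurve_of_kontsevichZagierPeriods (h : _root_.KontsevichZagierPeriods) :
    NeronTorsionComplexCurve := by
  have hK : KZKernelConjecture := kzKernelConjecture_iff_isRational.mpr h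
  intro b
  cases b
  · exact neronChordMember_false
  · intro g₂ g₃ e e' e'' xP yP yc yA yB α N a' b' M k m f _ _ _ _ _ _ _ _ _ _ _ _ _ _ _ _ _ _ _ _ _ rJ rC rL _ _ _ _
      _ _ hval
    apply hK
    rw [map_sub, map_add, map_zsmul, map_zsmul, map_zsmul, KZ.eval_of, KZ.eval_of, KZ.eval_of, zsmul_eq_mul,
      zsmul_eq_mul, zsmul_eq_mul]
    linarith [hval]

/-- The same as an implication `S → Rung`. -/
theorem onPath : _root_.KontsevichZagierPeriods → NeronTorsionComplexCurve :=
  neronTorsionComplexCurve_of_kontsevichZagierPeriods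

/-- The residual is a consequence of the crux (hence of the summit): `closure T ≤ closure (T ∪ T^{chord})`.
(Informational: stub 3 is WEAKER than the crux as typed.) [folklore] -/
theorem chordSectorComplete_of_torsionSectorComplete
    (h : Summit.KontsevichZagierPeriods.KontsevichZagierPeriods.Theses.TorsionLogs.TorsionSectorComplete) :
    ChordSectorComplete := by
  intro n m r r' hr hr' hv
  have hmono : Literature.NumberTheory.Transcendental.KZ.relations ⊔ AddSubgroup.closure TorsionTied ≤
      Literature.NumberTheory.Transcendental.KZ.relations ⊔ AddSubgroup.closure (TorsionTied ∪ ChordTied) :=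
    sup_le_sup_left (AddSubgroup.closure_mono Set.subset_union_left) _
  exact hmono (torsionSectorComplete_iff.mp h r r' hr hr' hv)

/-! ### Composition: the crux BY NAME from the three stubs -/

/-- **`TorsionSectorComplete` from the stubs** (closed term; `sorry` only through `stub_chordTriangle`,
`stub_orbitChain`, `stub_chordSectorComplete`): the rung (stubs 1–2) folds the chord sector into the moves
(`closure T^{chord} ≤ relations`), so the residual's `relations ⊔ closure (T ∪ T^{chord})` is `≤ relations ⊔ closure T`.
[cite: KontsevichZagier2001, §1.2] -/
theorem TorsionSectorComplete_of :
    Summit.KontsevichZagierPeriods.KontsevichZagierPeriods.Theses.TorsionLogs.TorsionSectorComplete := by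
  suffices key : ChordTriangle → OrbitChain → ChordSectorComplete →
      Summit.KontsevichZagierPeriods.KontsevichZagierPeriods.Theses.TorsionLogs.TorsionSectorComplete from
    key stub_chordTriangle stub_orbitChain stub_chordSectorComplete
  intro h₁ h₂ h₃
  rw [torsionSectorComplete_iff]
  intro n m r r' hr hr' hv
  have hR : NeronTorsionComplexCurve := neronTorsionComplexCurve_of h₁ h₂
  have hle : Literature.NumberTheory.Transcendental.KZ.relations ⊔ AddSubgroup.closure (TorsionTied ∪ ChordTied) ≤
      Literature.NumberTheory.Transcendental.KZ.relations ⊔ AddSubgroup.closure TorsionTied := by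
    refine sup_le le_sup_left ((AddSubgroup.closure_le _).mpr ?_)
    rintro d (hd | hd)
    · exact AddSubgroup.mem_sup_right (AddSubgroup.subset_closure hd)
    · exact AddSubgroup.mem_sup_left (closure_chordTied_le_relations (hR true) (AddSubgroup.subset_closure hd))
  exact hle (h₃ r r' hr hr' hv)

end Summit.KontsevichZagierPeriods.KontsevichZagierPeriods.Cruxes.TorsionSectorComplete.NeronTorsionComplexCurve

end
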